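import Summits.AtomisticToContinuum.BoseEinsteinCondensation.Theses.BECInsertionVariance
import Literature.MathematicalPhysics.QuantumManyBody.WeightedCorrector
import HarnessLib.Audit

/-!
# Birth skeleton (BC3) for crux `BECInsertionVariance.GroundStateHyperuniform`
(item stmt-AtomisticToContinuum-12065, route route-AtomisticToContinuum-BECInsertionVariance, rank 3;
seat planner-skel-stmt-AtomisticToContinuum-12065-0, 2026-08-17, mode skeleton-register)

Crux (fixed, concluded BY NAME below): for every repulsive finite-range `v` and all small `ρ` there is `C`
with, for all large `N = n+1` and every mode `k = 2πm/L`, `m ≠ 0`, `|k| ≤ √(ρa)`,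
`structureFactorVar N L Ψ₀ m = Var_{Ψ₀²}(∑ⱼ e^{ik·xⱼ}) ≤ C·N·|k|/√(ρa)` for THE nonnegative Dirichlet
ground state `Ψ₀ = groundState v N L`, `L = (N/ρ)^{1/3}` (uniform hyperuniformity down to the lowest mode).

## The line (the route's own two-layer plan for H: SchwarzSumRule → StaticResponseBound → H)

Onsager–Price / Pitaevskii–Stringari: the moment (Schwarz) inequality `m₀² ≤ m₁ · m₋₁` for the density
wave, with the f-sum rule `m₁ ≤ N|k|²` and a static-response (compressibility) bound `m₋₁ ≤ C N/(ρa)`,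
gives `N S_N(k) ≤ |k| √(N · C N/(ρa))`, i.e. `S_N(k) ≤ √C |k|/√(ρa)` [Stringari1995 §2.2 (9)–(11), §3 (40);
PitaevskiiStringari1991].  Both ingredients are typed in the GROUND-STATE REPRESENTATION (Davies'
transference `F ↦ FΨ₀`, `⟨FΨ₀,(H−E₀)FΨ₀⟩ = ∫ |∇F|² Ψ₀²`), exactly the "variational dress" in which the
torus twin `BECInsertionCorrector.StaticResponseBound` (stmt-…-12057) is consumed by its landed brick
`stub_responseToHyperuniformity` (Theorems/…ResponseToHyperuniformity.lean): no resolvent, no perturbed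
infimum, only integrals against `Ψ₀²`.  For the modulation `U_s = ∑ⱼ (1 + cos(k·xⱼ − s))` (phase `s`
covers the real and imaginary parts of `ρ̂_k`; `U_s ≥ 0`), centred at its ground-state mean
`Ū_s = ∫ U_s Ψ₀²`, the ALL-STATES DISCRIMINANT with constant `A` is

  `(∫ (U_s − Ū_s) F² Ψ₀²)² ≤ 4A · (∫ F² Ψ₀²) · (∫ |∇F|² Ψ₀²)`  for every Bose-symmetric `C¹` test `F`
  bounded with bounded gradient                                                            (D_A)

(= `E[FΨ₀/‖FΨ₀‖] + t⟨U_s⟩ ≥ E₀ + tŪ_s − A t²` for all `t`, the Dirichlet analogue of the torus crux's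
certified normal form `⟨∑cos⟩_Ψ² ≤ 4CN(E_Ψ − E₀)/max(ρa,|p|²)`; its `t → 0` shadow is `m₋₁(U_s) ≤ A`).

* `stub_schwarzSumRule` (size M, provable now; the Dirichlet port of the landed torus brick B2):
  for ANY `v, n, L, m, A`: (D_A for every phase `s`) ⟹ `structureFactorVar (n+1) L Ψ₀ m ≤ 2|k|√((n+1)A)`.
  Proof intended: test `F_ε = 1 + ε(U_s − Ū_s)` (symmetric, `C¹`, bounded), expand, `ε → 0`:
  `Var(U_s)² ≤ A ∫|∇U_s|²Ψ₀² ≤ A |k|²(n+1)` (`|∇U_s|² = |k|² ∑ⱼ sin² ≤ (n+1)|k|²`, `∫Ψ₀² ≤ 1` in both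
  branches of `groundState`); `structureFactorVar = Var(U_0) + Var(U_{π/2})`
  (`structureFactorVar_eq_lintegral_sub_mean`).  Junk branch `Ψ₀ = 0`: both sides vanish.  `A < 0` with a
  genuine `Ψ₀` makes (D_A) false unless the variance is `0` — consistent (`Real.sqrt` of a negative is `0`).
* `stub_staticResponseBound` (size XL, THE HARD STUB — the Dirichlet static-response / compressibility
  bound of the route header, "LHY-precision inhomogeneous lower bound for `H_N + λ∑cos(k·xᵢ)`"): for `v`
  admissible there is `ρ₀` and, for `0 < ρ < ρ₀`, a constant `C` with, eventually in `n`, for every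
  `m ≠ 0` in the window `|k| ≤ √(ρa)` and every phase `s`: (D_A) with `A = C (n+1)/(ρa)`
  (Bogoliubov/LDA value `m₋₁(U_s)/N = ½/(k² + 16πρa) ≤ 1/(32πρa)`).  Trivially true in the junk branch.
* `GroundStateHyperuniform_of` (sorry-free glue, below): thresholds from B, `C_H = 2√C`, the real identity
  `2k√((n+1)·C(n+1)/(ρa)) = 2√C (n+1) k/√(ρa)` (all sign/zero cases), conclusion = the crux BY NAME.

Hardest stub: `stub_staticResponseBound` (it IS the open core: N-uniform second-order response of the
dilute gas down to `k = 2π/L`, cf. the torus twin's STRATEGY-CENSUS "wall" D1/D2; in the Dirichlet box the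
wall layer is the extra risk recorded in the crux's why-it-might-fail).  Why the cut is not a costume:
B is an energy-response statement about ALL multiplicative deformations `FΨ₀` (strictly more than the
variance of one observable), A is a genuine theorem (moment inequality + f-sum rule) converting response
into variance; neither is the crux reworded (BC3 probes `stub → crux`, `stub → BoseEinsteinCondensation`
by `first | exact? | simpa | aesop` fail, see the seat's NOTES.md).

Disproof used: this crux has no `Disproof.lean` yet (`ledger crux ls`: no workfiles).  Typing lessons taken
from the torus twin's standing disproof (Cruxes/StaticResponseBound/Disproof.lean): `m ≠ 0` kept
(§B, `k ≠ 0` load-bearing); finite-energy guard ⇝ here the test class is bounded `C¹` with bounded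
gradient, so every integral against the (sub)probability weight `Ψ₀²` converges (no Bochner-junk
vacuity, checklist 4c(ii)); the constant is existential per `(v, ρ)` (§C tightness `C ≥ 1/2`, §F order of
quantifiers).  Negatives index (20 entries, 2026-08-17): nothing on structure factors / static response.
Barriers: `KineticGapLengthScalesNarrow` — no box-localisation/gap step is typed here (B is a response
coefficient at fixed `k`, not a depletion bound); `BogoliubovPerturbationInfraredNarrow` — only static,
gauge-invariant objects (`U_s`, `Ψ₀²`, `∫|∇F|²Ψ₀²`) enter.
-/

namespace Summit.AtomisticToContinuum.BoseEinsteinCondensation.Cruxes.GroundStateHyperuniform.Birth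

open MeasureTheory Filter
open scoped ENNReal BigOperators
open Summit.AtomisticToContinuum.BoseEinsteinCondensation.Theses.BECInsertionVariance

noncomputable section

/-! ## Registered stubs -/

/-- **Stub A — Schwarz / uncertainty sum rule in the ground-state representation** (Onsager–Price,
Pitaevskii–Stringari `m₀² ≤ m₁ m₋₁` with the f-sum rule `m₁ ≤ (n+1)|k|²`): if, for every phase `s`, the
centred modulation `U_s − Ū_s`, `U_s = ∑ⱼ (1 + cos(k·xⱼ − s))`, satisfies the all-states discriminant
with constant `A` against the weight `Ψ₀²` of the nonnegative Dirichlet ground state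
`Ψ₀ = groundState v (n+1) L` (every Bose-symmetric bounded `C¹` test `F` with bounded gradient), then
`N S_N(k) = structureFactorVar (n+1) L Ψ₀ m ≤ 2|k|√((n+1)A)`, `k = 2π|m|/L`.  No hypothesis on
`v, L, m, A` (junk branch: both sides `0`).  Size M. [cite: Stringari1995, §2.2 (9)–(11) and §3 (40)]
[cite: PitaevskiiStringari1991] -/
theorem stub_schwarzSumRule : ∀ (v : ℝ → ENNReal) (n : ℕ) (L : ℝ) (m : Fin 3 → ℤ) (A : ℝ), (∀ s : ℝ, let Ψ₀ : Literature.MathematicalPhysics.QuantumManyBody.BoseGas.Config (n + 1) → ℝ := Literature.MathematicalPhysics.QuantumManyBody.BoseGas.groundState v (n + 1) L; let U : Literature.MathematicalPhysics.QuantumManyBody.BoseGas.Config (n + 1) → ℝ := fun X => ∑ j : Fin (n + 1), (1 + Real.cos (2 * Real.pi / L * (∑ t : Fin 3, (m t : ℝ) * X j t) - s)); let Ubar : ℝ := ∫ X, U X * Ψ₀ X ^ 2; ∀ F : Literature.MathematicalPhysics.QuantumManyBody.BoseGas.Config (n + 1) → ℝ, ContDiff ℝ 1 F → (∀ (σ :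 Equiv.Perm (Fin (n + 1))) (X : Literature.MathematicalPhysics.QuantumManyBody.BoseGas.Config (n + 1)), F (X ∘ σ) = F X) → (∃ M : ℝ, ∀ X, |F X| ≤ M ∧ Literature.MathematicalPhysics.QuantumManyBody.BoseGas.gradDot F F X ≤ M) → (∫ X, (U X - Ubar) * F X ^ 2 * Ψ₀ X ^ 2) ^ 2 ≤ 4 * A * (∫ X, F X ^ 2 * Ψ₀ X ^ 2) * (∫ X, Literature.MathematicalPhysics.QuantumManyBody.BoseGas.gradDot F F X * Ψ₀ X ^ 2)) → Literature.MathematicalPhysics.QuantumManyBody.BoseGas.structureFactorVar (n + 1) L (fun X => (Literature.MathematicalPhysics.QuantumManyBody.BoseGas.groundState v (n + 1) L X : ℂ)) m ≤ ENNReal.ofReal (2 * (2 * Real.pi / L * ‖(WithLp.toLp 2 fun t => (m t : ℝ) : EuclideanSpace ℝ (Fin 3))‖) * Real.sqrt ((n + 1) * A)) := by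
  sorry

/-- **Stub B — static response bound for the Dirichlet ground state (all-states discriminant,
ground-state representation)**: for every repulsive finite-range `v` there is `ρ₀ > 0` and, for
`0 < ρ < ρ₀`, a constant `C` such that for all large `N = n+1`, every mode `m ≠ 0` with
`k = 2π|m|/L ≤ √(ρa)` (`L = (N/ρ)^{1/3}`, `a` the scattering length) and every phase `s`, the centred
modulation `U_s − Ū_s` obeys the discriminant with `A = C (n+1)/(ρa)`:
`(∫ (U_s − Ū_s)F²Ψ₀²)² ≤ 4·(C(n+1)/(ρa))·(∫F²Ψ₀²)(∫|∇F|²Ψ₀²)` for every Bose-symmetric bounded `C¹` test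
`F` with bounded gradient — equivalently `E[FΨ₀/‖FΨ₀‖] + t⟨U_s⟩ ≥ E₀ + tŪ_s − C N t²/(ρa)` for all `t`
(second-order energy response `≤ C N/(ρa)`, Bogoliubov value `N/(32πρa)`).  Junk branch `Ψ₀ = 0`:
trivially true.  THE HARD STUB (size XL): Dirichlet twin of `BECInsertionCorrector.StaticResponseBound`.
[cite: PitaevskiiStringari1991] [cite: Stringari1995, §2.2 (11)] [cite: FournaisSolovej2020]
[cite: LSSY2005, Ch. 5] -/
theorem stub_staticResponseBound : ∀ v : ℝ → ENNReal, Literature.MathematicalPhysics.QuantumManyBody.BoseGas.IsRepulsiveFiniteRange v → ∃ ρ₀ : ℝ, 0 < ρ₀ ∧ ∀ ρ : ℝ, 0 < ρ → ρ < ρ₀ → ∃ C : ℝ, ∀ᶠ n : ℕ in Filter.atTop, ∀ m : Fin 3 → ℤ, m ≠ 0 → let L : ℝ := Literature.MathematicalPhysics.QuantumManyBody.BoseGas.sideLength ρ (n + 1); let a : ℝ := (Literature.MathematicalPhysics.QuantumManyBody.BoseGas.scatteringLength v).toReal; let k : ℝ := 2 * Real.pi / L * ‖(WithLp.toLp 2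 fun t => (m t : ℝ) : EuclideanSpace ℝ (Fin 3))‖; k ≤ Real.sqrt (ρ * a) → ∀ s : ℝ, let Ψ₀ : Literature.MathematicalPhysics.QuantumManyBody.BoseGas.Config (n + 1) → ℝ := Literature.MathematicalPhysics.QuantumManyBody.BoseGas.groundState v (n + 1) L; let U : Literature.MathematicalPhysics.QuantumManyBody.BoseGas.Config (n + 1) → ℝ := fun X => ∑ j : Fin (n + 1), (1 + Real.cos (2 * Real.pi / L * (∑ t : Fin 3, (m t : ℝ) * X j t) - s)); let Ubar : ℝ := ∫ X, U X * Ψ₀ X ^ 2; ∀ F : Literature.MathematicalPhysics.QuantumManyBody.BoseGas.Config (n + 1) → ℝ, ContDiff ℝ 1 F → (∀ (σ : Equiv.Perm (Fin (n + 1))) (X : Literature.MathematicalPhysics.QuantumManyBody.BoseGas.Config (n + 1)), F (X ∘ σ) = F X) → (∃ M : ℝ, ∀ X, |F X| ≤ M ∧ Literature.MathematicalPhysics.QuantumManyBody.BoseGas.gradDot F F X ≤ M) → (∫ X, (U X - Ubar) * F X ^ 2 * Ψ₀ X ^ 2) ^ 2 ≤ 4 * (C * (n + 1) / (ρ * a))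 * (∫ X, F X ^ 2 * Ψ₀ X ^ 2) * (∫ X, Literature.MathematicalPhysics.QuantumManyBody.BoseGas.gradDot F F X * Ψ₀ X ^ 2) := by
  sorry

/-! ## Glue (sorry-free) -/

/-- The constant bookkeeping `2k·√((n+1)·(C(n+1)/x)) = 2√C·(n+1)·k/√x` for `x ≥ 0`, in every sign/zero
case (`x = 0`: both sides are `0` by `y/0 = 0`; `C < 0`: both sides are `0` by `√(negative) = 0`).
[folklore] -/
theorem two_mul_k_mul_sqrt_eq (n : ℕ) (k C x : ℝ) (hx : 0 ≤ x) :
    2 * k * Real.sqrt ((n + 1) * (C * (n + 1) / x)) = 2 * Real.sqrt C * (n + 1) * k / Real.sqrt x := by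
  have hn : (0 : ℝ) < n + 1 := by positivity
  rcases hx.eq_or_lt with hx0 | hx0
  · subst hx0
    simp
  by_cases hC : 0 ≤ C
  · have hsx : 0 < Real.sqrt x := Real.sqrt_pos.mpr hx0
    have h1 : Real.sqrt ((n + 1) * (C * (n + 1) / x)) = (n + 1) * Real.sqrt C / Real.sqrt x := by
      have h2 : (n + 1) * (C * (n + 1) / x) = ((n + 1) * Real.sqrt C / Real.sqrt x) ^ 2 := by
        rw [div_pow, mul_pow, Real.sq_sqrt hC, Real.sq_sqrt hx0.le]
        field_simp
      rw [h2, Real.sqrt_sq (by positivity)]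
    rw [h1]
    field_simp
  · push Not at hC
    have hC0 : Real.sqrt C = 0 := Real.sqrt_eq_zero'.mpr hC.le
    have hneg : (n + 1) * (C * (n + 1) / x) ≤ 0 := by
      have : C * (n + 1) / x ≤ 0 :=
        div_nonpos_of_nonpos_of_nonneg (mul_nonpos_of_nonpos_of_nonneg hC.le hn.le) hx0.le
      exact mul_nonpos_of_nonneg_of_nonpos hn.le this
    rw [Real.sqrt_eq_zero'.mpr hneg, hC0]
    simp

/-- **`GroundStateHyperuniform` from the registered stubs** (kernel-checked composition, no `sorry` of
its own): thresholds `ρ₀` and the constant `C` from `stub_staticResponseBound`; the crux constant is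
`C_H := 2√C`; eventually in `n`, for `m ≠ 0` in the window, `stub_schwarzSumRule` at
`A := C(n+1)/(ρa)` (its hypothesis is B's conclusion verbatim) and the bookkeeping identity
`two_mul_k_mul_sqrt_eq` (`ρa ≥ 0` since `ρ > 0`, `a = toReal ≥ 0`). [folklore] -/
theorem GroundStateHyperuniform_of : GroundStateHyperuniform := by
  intro v hv
  obtain ⟨ρ₀, hρ₀, hB⟩ := stub_staticResponseBound v hv
  refine ⟨ρ₀, hρ₀, fun ρ hρ hρ' => ?_⟩
  obtain ⟨C, hC⟩ := hB ρ hρ hρ'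
  refine ⟨2 * Real.sqrt C, ?_⟩
  filter_upwards [hC] with n hn
  intro m hm L a k hk
  have hA := stub_schwarzSumRule v n L m (C * (n + 1) / (ρ * a)) (hn m hm hk)
  refine hA.trans (le_of_eq ?_)
  have hx : 0 ≤ ρ * a := mul_nonneg hρ.le ENNReal.toReal_nonneg
  rw [two_mul_k_mul_sqrt_eq n k C (ρ * a) hx]

end

end Summit.AtomisticToContinuum.BoseEinsteinCondensation.Cruxes.GroundStateHyperuniform.Birth
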